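import Literature.Probability.Percolation.ArmSeparationExtSlotPairs
import HarnessLib

/-!
# A ring tube off the window misses a rotated radial band

Topic `Literature/Probability/Percolation`; family `crit-perc` / near-critical percolation on `𝕋`.
A brick of the near-critical arm-separation theorem for four arms in the ADJACENT colour
arrangement (P. Nolin, EJP 13 (2008), Thm. 11, `j = 4`, `σ = BBWW` [arXiv 0711.4948: Thm. 10],
landing step, §4.3 Lemma 13, §4.4): the generic geometry behind the disjointness of the corridors
(and of the supports of Nolin's Lemma 13 [arXiv Lemma 12]) in the rotation-read world —
`ringTube_disjoint_rotRows`, the common generalisation of `ringTube_disjoint_rotSpoke`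
(`ArmSeparationExtSlotPairs.lean`) from a spoke aligned in one chunk to an arbitrary set of frame
points with rows in `[y₁, y₂]` beyond `∂Λ_{2M}` in the middle of the side (a spoke, an approach
strip): a tube of the thin ring `(r, e, s)` whose position is outside the window
`[blockOff n i + 2(latIdx y₁ - 2), blockOff n i + 2(latIdx y₂ - 2) + 7]` of the side `i` misses the
`ρ^i`-image of the set (other sides: the sectors; the side `i`: the lateral coordinate, with the
one-chunk smear of the diagonal sides `2, 5`). Also the norm of rotated frame points
(`norm_of_mem_image_rot`).

Everything here is proved; no named facts are introduced.

## References

* P. Nolin, Near-critical percolation in two dimensions, *Electron. J. Probab.* 13 (2008), §4.3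
  Lemma 13, §4.4 (arXiv 0711.4948: Lemma 12; proof of Thm. 10) [Nolin2008].
-/

noncomputable section

open Set

namespace Literature.Probability.Percolation

open LatticeModels

/-- **The norm of a rotated frame point beyond the side is its depth.** [folklore] -/
theorem norm_of_mem_image_rot {i M : ℕ} {B : Set (Site 2)}
    (hdep : ∀ u ∈ B, 2 * (M : ℤ) + 1 ≤ u 0 ∧ -(2 * (M : ℤ)) ≤ u 1 ∧ u 1 ≤ 0) {v : Site 2} (hv : v ∈ triRotIsoPow i '' B) :
    ∃ u ∈ B, triRotIsoPow i u = v ∧ triNorm v = u 0 := by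
  obtain ⟨u, hu, rfl⟩ := hv
  obtain ⟨h0, h1, h1'⟩ := hdep u hu
  exact ⟨u, hu, rfl, norm_rot_eq i h0 h1 h1'⟩

/-- **A ring tube off the window misses a rotated radial band.** The ring of radius `r = n s`
(`e` the half-width, `2e ≤ r`, `3e < s`), its `g`-th tube, `g` outside the window of the side `ic`
spanned by the lateral indices `latIdx y₁ - 2, …, latIdx y₂ + 1` (`2 ≤ latIdx y₁`,
`latIdx y₂ + 3 ≤ n`); the set `B` of frame points with rows in `[y₁, y₂]`, in the sector
(`u₁ ≤ -lamS`, `lamS ≤ u₀ + u₁`, `2e < lamS`) and beyond the side (`2M + 1 ≤ u₀`, `-2M ≤ u₁ ≤ 0`). [cite: Nolin2008, §4.3 Lemma 13 (arXiv 0711.4948: Lemma 12)] -/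
theorem ringTube_disjoint_rotRows {r e s n g ic M : ℕ} {B : Set (Site 2)} {y₁ y₂ lamS : ℤ}
    (hn : 1 ≤ n) (hns : n * s = r) (he : 2 * e ≤ r) (hg : g < 12 * n - 4) (hic : ic < 6)
    (h2 : 2 ≤ latIdx s r y₁) (hιn : latIdx s r y₂ + 3 ≤ n) (hy1 : -(r : ℤ) ≤ y₁)
    (hout : g < blockOff n ic + 2 * (latIdx s r y₁ - 2) ∨ blockOff n ic + 2 * (latIdx s r y₂ - 2) + 7 < g)
    (hes : 3 * e < s) (hlam : 2 * (e : ℤ) < lamS)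
    (hrows : ∀ u ∈ B, y₁ ≤ u 1 ∧ u 1 ≤ y₂)
    (hsec : ∀ u ∈ B, u 1 ≤ -lamS ∧ lamS ≤ u 0 + u 1)
    (hdep : ∀ u ∈ B, 2 * (M : ℤ) + 1 ≤ u 0 ∧ -(2 * (M : ℤ)) ≤ u 1 ∧ u 1 ≤ 0)
    {v : Site 2} (hvT : v ∈ (ringTube r e s g).box) (hv : v ∈ triRotIsoPow ic '' B) : False := by
  have hs : 1 ≤ s := by omega
  have hr : n = r / s := by rw [← hns, Nat.mul_div_cancel _ hs]
  obtain ⟨u, hu, rfl⟩ := hv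
  obtain ⟨hu1, hu2⟩ := hsec u hu
  obtain ⟨hd0, hd1, hd1'⟩ := hdep u hu
  obtain ⟨hr1, hr2⟩ := hrows u hu
  have hnorm : triNorm (triRotIsoPow ic u) = u 0 := norm_rot_eq ic hd0 hd1 hd1'
  subst hr
  have hg' : g < 12 * (r / s) - 4 := hg
  obtain ⟨hsecT, hlat1, hlat2, hn1, hn2⟩ := ringTube_bounds hn ⟨_, hns.symm.trans (mul_comm _ _)⟩ he hg' hvT
  rw [hnorm] at hn1 hn2
  set sd := ringSide r s g with hsd
  have hsd6 : sd < 6 := ringSide_lt r s g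
  by_cases hside : sd = ic
  · -- same side: the lateral coordinate
    have hlat := lat_rot hic u
    rw [hside] at hlat1 hlat2
    rw [hlat] at hlat1 hlat2
    have hpos := pos_le_of_side_lat hn hg'
    rw [← hsd, hside] at hpos
    have hιlt : ringLat r s g < r / s := ringLat_lt hn
    have hns' : ((r / s : ℕ) : ℤ) * s = r := by exact_mod_cast hns
    have hs0 : 0 < s := hs
    have he3 : (3 * e : ℤ) < s := by exact_mod_cast hes
    have he1 : (e : ℤ) < s := by linarith
    -- the chunk of the row of `u`
    have hu1r : -(r : ℤ) ≤ u 1 := le_trans hy1 hr1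
    set ιc := latIdx s r (u 1) with hιc
    have hspec := latIdx_spec (s := s) (r := r) hs hu1r
    rw [← hιc] at hspec
    have hι1 : latIdx s r y₁ ≤ ιc := latIdx_mono hr1
    have hι2 : ιc ≤ latIdx s r y₂ := latIdx_mono hr2
    have h2' : 2 ≤ ιc := h2.trans hι1
    have hιn' : ιc + 3 ≤ r / s := by omega
    have hrange : if ic % 3 = 2 then r / s - ιc - 2 ≤ ringLat r s g ∧ ringLat r s g ≤ r / s - ιc + 1
        else ιc - 1 ≤ ringLat r s g ∧ ringLat r s g ≤ ιc + 1 := by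
      by_cases h : ic % 3 = 2
      · rw [if_pos h]
        rw [if_pos h] at hlat1 hlat2
        have hB : ((r / s - ιc - 2 : ℕ) : ℤ) = (r / s : ℕ) - ιc - 2 := by omega
        have hB' : ((r / s - ιc + 1 : ℕ) : ℤ) = (r / s : ℕ) - ιc + 1 := by omega
        constructor
        · refine idx_le_of_mul_le (s := s) (c := 3 * e) hs0 ?_ he3
          rw [hB]
          linarith only [hlat2, hn2, hspec.2, hns']
        · refine idx_le_of_mul_le (s := s) (c := 3 * e) hs0 ?_ he3
          rw [hB']
          linarith only [hlat1, hn1, hspec.1, hns']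
      · rw [if_neg h]
        rw [if_neg h] at hlat1 hlat2
        constructor
        · have : ιc ≤ ringLat r s g + 1 := by
            refine idx_le_of_mul_le (s := s) (c := e) hs0 ?_ he1
            push_cast
            linarith only [hlat2, hspec.1]
          omega
        · refine idx_le_of_mul_le (s := s) (c := e) hs0 ?_ he1
          push_cast
          linarith only [hlat1, hspec.2]
    have hwin := piecePos_mem_window (n := r / s) (i := ic) (ι := ringLat r s g) (ιc := ιc) hιlt h2' hιn' hrange
    omega
  · -- another side: the sectors
    have hmem : triRotIsoPow ic u ∈ sectorNear ic lamS := (rot_mem_sectorNear_iff hic).2 ⟨hu1, hu2⟩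
    exact Set.disjoint_left.1 (disjoint_sectorNear hsd6 hic hside (by linarith)) hsecT hmem

end Literature.Probability.Percolation
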